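import Summits.PneNP.PneNP.Theorems.ChebyshevTracialDesignJuntaMatchingLaw
import HarnessLib

/-!
# Junta virtual positivity, part F: matching-side junta pairs have design value `≤ 0`

Support file for the crux `TracialDecayExp20` (stmt-PneNP-19878; also the aside `TracialDecay20`,
stmt-PneNP-19646) of route `ChebyshevTracialDesign` — the MATCHING-SIDE twin of part C
(`ChebyshevTracialDesignJuntaVirtualPositivity`): for an exact extrapolation design `(C, w)` of degree `D`
on the `t`-cuts of `K_n` and psd families `X : OddSet n → Sym_r⁺` (arbitrary), `Y : PMatch n → Sym_r⁺` with
`Y_M` depending only on the window edges `M[A] = {e ∈ M : e meets A}`, `|A| ≤ D`, the design value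
`Σ_U Σ_M levelWeight(U,M)·tr(X_U Y_M)` is `≤ 0` (`sum_levelWeight_trace_nonpos_of_junta_matching`;
balanced `dq/Tq` corollary `juntaVirtualPositivity_bal_matching`). With part C: a tight psd strategy can
have positive design value only if BOTH factors are non-junta — the spread × spread part of the crux's
structure step (N2) is all that remains. Mechanism: per cut `U` the level sums are `#{M : cc = c}·P_U(c)`
(part E), `#{M : cc(U,M) = c}·(c!·2^i i!·2^{i'} i'!) = t!(n-t)!` depends on `|U| = t` only (part D),
exactness gives value `= -(#{U : |U| = t})⁻¹ Σ_U P_U(0) ≤ 0`.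
-/

set_option linter.dupNamespace false -- `Summit.PneNP.PneNP.…`: summit = sub-problem (D-0017)

namespace Summit.PneNP.PneNP.Theorems.ChebyshevTracialDesignJunta

open Finset Literature.Barriers.PneNP Literature.Combinatorics.SimpleGraph.CycleSpace

/-! ### Part F: matching-side junta virtual positivity for exact designs

Twin of part C with the junta hypothesis on the MATCHING side: `Y_M` depends only on the window edges
`M[A] = {e ∈ M : e meets A}`, `|A| ≤ D`; `X` arbitrary psd. Per cut `U` the level sums are
`#{M : cc(U,M) = c}·P_U(c)` (part E), `#{M : cc(U,M) = c}` depends only on `|U| = t`, and exactness gives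
value `= -(#{U : |U| = t})⁻¹ Σ_U P_U(0) ≤ 0`. -/

section DesignM

open Polynomial Matrix Literature.Combinatorics.Optimization

variable {n : ℕ}

/-- **Per-cut level sums through `perfectMatchings univ`**: for `|U| = t`,
`Σ_{M : PMatch n, cc(U,M) = c} tr(X_U Y_M) = Σ_{M' ∈ PM(univ), #cr(U,M') = c} g_U(M')`. [folklore] -/
theorem sum_pmatch_level_eq (U : OddSet n) {t c : ℕ} (hUt : U.1.card = t) {r : ℕ}
    (X : OddSet n → Matrix (Fin r) (Fin r) ℝ) (Y : PMatch n → Matrix (Fin r) (Fin r) ℝ) :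
    ∑ M : PMatch n, (if U.1.card = t ∧ cc U M = c then (X U * Y M).trace else 0) =
      ∑ M' ∈ (perfectMatchings (univ : Finset (Fin n))).filter
          (fun M' => (M'.filter fun e => cutCount U.1 e = 1).card = c),
        (if h : IsPMOn (univ : Finset (Fin n)) M' then (X U * Y ⟨M', h⟩).trace else 0) := by
  classical
  set φ : Finset (Sym2 (Fin n)) → ℝ := fun M' =>
    if (M'.filter fun e => cutCount U.1 e = 1).card = c then
      (if h : IsPMOn (univ : Finset (Fin n)) M' then (X U * Y ⟨M', h⟩).trace else 0) else 0 with hφ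
  have h1 : ∑ M : PMatch n, (if U.1.card = t ∧ cc U M = c then (X U * Y M).trace else 0) =
      ∑ M : PMatch n, φ M.1 := by
    refine Fintype.sum_congr _ _ fun M => ?_
    rw [hφ]
    simp only [hUt, true_and, cc_eq_card_filter, dif_pos M.2]
  have h2 : ∑ M : PMatch n, φ M.1 = ∑ M' ∈ perfectMatchings (univ : Finset (Fin n)), φ M' :=
    (sum_subtype _ (fun M' => mem_perfectMatchings) φ).symm
  rw [h1, h2, hφ, ← sum_filter]

/-- **Junta virtual positivity, matching side** (cell pnp-psdrank (N1), twin): for an exact design of degree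
`D` on the `t`-cuts and a psd pair `(X, Y)` with `Y_M` depending only on the window edges `M[A]`,
`|A| ≤ D` (and `X` arbitrary), the design value `Σ_U Σ_M W(U,M)·tr(X_U Y_M)` is `≤ 0`. [folklore] -/
theorem sum_levelWeight_trace_nonpos_of_junta_matching {t T D : ℕ} {Bv : ℝ} {C : Finset ℕ} {w : ℕ → ℝ}
    (hdes : IsExactDesign n t T D Bv C w) {r : ℕ} (A : Finset (Fin n)) (hAD : A.card ≤ D)
    (X : OddSet n → Matrix (Fin r) (Fin r) ℝ) (Y : PMatch n → Matrix (Fin r) (Fin r) ℝ)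
    (hY : ∀ M M' : PMatch n, M.1.filter (fun e => ∃ a ∈ A, a ∈ e) = M'.1.filter (fun e => ∃ a ∈ A, a ∈ e) →
      Y M = Y M')
    (hXpsd : ∀ U, (X U).PosSemidef) (hYpsd : ∀ M, (Y M).PosSemidef) :
    ∑ U, ∑ M, levelWeight n t C w U M * (X U * Y M).trace ≤ 0 := by
  obtain ⟨htodd, htn, hTt, hC, -, hexact, -⟩ := hdes
  have htr : ∀ (U : OddSet n) (M : PMatch n), 0 ≤ (X U * Y M).trace := fun U M =>
    (show HasPsdFactorization (fun U M => (X U * Y M).trace) r from ⟨X, Y, hXpsd, hYpsd, fun _ _ => rfl⟩).nonneg U M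
  -- Step 1: the value as level sums (cut outside)
  have hval : ∑ U, ∑ M, levelWeight n t C w U M * (X U * Y M).trace =
      ∑ c ∈ C, w c / ((Qset n t c).card : ℝ) *
        ∑ U : OddSet n, ∑ M : PMatch n, (if U.1.card = t ∧ cc U M = c then (X U * Y M).trace else 0) := by
    calc ∑ U, ∑ M, levelWeight n t C w U M * (X U * Y M).trace
        = ∑ U, ∑ M, ∑ c ∈ C, (if (U, M) ∈ Qset n t c then w c / ((Qset n t c).card : ℝ) * (X U * Y M).trace
            else 0) := by
          refine sum_congr rfl fun U _ => sum_congr rfl fun M _ => ?_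
          rw [levelWeight, sum_mul]
          exact sum_congr rfl fun c _ => by split_ifs <;> simp
      _ = ∑ U, ∑ c ∈ C, ∑ M, (if (U, M) ∈ Qset n t c then w c / ((Qset n t c).card : ℝ) * (X U * Y M).trace
            else 0) := sum_congr rfl fun U _ => sum_comm
      _ = ∑ c ∈ C, ∑ U, ∑ M, (if (U, M) ∈ Qset n t c then w c / ((Qset n t c).card : ℝ) * (X U * Y M).trace
            else 0) := sum_comm
      _ = ∑ c ∈ C, w c / ((Qset n t c).card : ℝ) *
            ∑ U : OddSet n, ∑ M : PMatch n, (if U.1.card = t ∧ cc U M = c then (X U * Y M).trace else 0) := by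
          refine sum_congr rfl fun c _ => ?_
          rw [mul_sum]
          refine sum_congr rfl fun U _ => ?_
          rw [mul_sum]
          refine sum_congr rfl fun M _ => ?_
          simp only [mem_Qset_iff]
          split_ifs <;> simp
  -- Step 2: per cut, the polynomial from the matching-side junta sum law
  have hcardc : ∀ U : OddSet n, ((univ : Finset (Fin n)) \ U.1).card = n - U.1.card := fun U => by
    rw [card_sdiff_of_subset (subset_univ _), card_univ, Fintype.card_fin]
  have hP : ∀ U : OddSet n, ∃ P : Polynomial ℝ, P.natDegree ≤ D ∧ 0 ≤ P.eval 0 ∧ (U.1.card ≠ t → P = 0) ∧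
      (U.1.card = t → ∀ c i i' : ℕ, c + 2 * i = t → c + 2 * i' = n - t →
        ∑ M : PMatch n, (if U.1.card = t ∧ cc U M = c then (X U * Y M).trace else 0) =
          ((((perfectMatchings (univ : Finset (Fin n))).filter fun M' =>
              (M'.filter fun e => cutCount U.1 e = 1).card = c).card : ℕ) : ℝ) * P.eval (c : ℝ)) := by
    intro U
    by_cases hUt : U.1.card = t
    · obtain ⟨P, hPdeg, hP0, hPval⟩ := junta_sum_law_pm (subset_univ U.1) hUt
        (by rw [hcardc U, hUt]) A (subset_univ A)
        (fun M' => if h : IsPMOn (univ : Finset (Fin n)) M' then (X U * Y ⟨M', h⟩).trace else 0)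
        (fun E => if h : ∃ M : PMatch n, M.1.filter (fun e => ∃ a ∈ A, a ∈ e) = E then
          (X U * Y h.choose).trace else 0)
        (fun M' hM' => by
          rw [mem_perfectMatchings] at hM'
          simp only [dif_pos hM']
          split_ifs with h
          · have hYeq : Y h.choose = Y ⟨M', hM'⟩ :=
              hY _ _ (by convert h.choose_spec using 1; ext e; simp [Finset.mem_filter])
            rw [hYeq]
          · exact absurd ⟨⟨M', hM'⟩, by convert rfl⟩ h)
        (fun E => by
          split_ifs with h
          · exact htr _ _
          · exact le_refl _)
      refine ⟨P, hPdeg.trans hAD, hP0, fun h => absurd hUt h, fun _ c i i' hci hci' => ?_⟩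
      rw [sum_pmatch_level_eq U hUt X Y, hPval c i i' hci hci']
    · exact ⟨0, by simp, by simp, fun _ => rfl, fun h => absurd h hUt⟩
  choose P hPdeg hP0 hPzero hPval using hP
  -- Step 3: the number of matchings at level `c` over a `t`-cut, and `|Q_c|`
  have htot : ∀ (U : OddSet n), U.1.card = t → ∀ c i i' : ℕ, c + 2 * i = t → c + 2 * i' = n - t →
      ((((perfectMatchings (univ : Finset (Fin n))).filter fun M' =>
          (M'.filter fun e => cutCount U.1 e = 1).card = c).card : ℕ) : ℝ) *
        ((c.factorial * (2 ^ i * i.factorial) * (2 ^ i' * i'.factorial) : ℕ) : ℝ) =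
        ((t.factorial * (n - t).factorial : ℕ) : ℝ) := by
    intro U hUt c i i' hci hci'
    have key := card_pm_filter_cr_mul (subset_univ U.1) (a := c) (i := i) (i' := i')
      (by rw [hUt, hci]) (by rw [hcardc U, hUt, hci'])
    rw [hci, hci'] at key
    exact_mod_cast key
  have hQ : ∀ c i i' : ℕ, c + 2 * i = t → c + 2 * i' = n - t →
      ((Qset n t c).card : ℝ) * ((c.factorial * (2 ^ i * i.factorial) * (2 ^ i' * i'.factorial) : ℕ) : ℝ) =
        (∑ U : OddSet n, (if U.1.card = t then (1 : ℝ) else 0)) * ((t.factorial * (n - t).factorial : ℕ) : ℝ) := by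
    intro c i i' hci hci'
    have e1 : ((Qset n t c).card : ℝ) =
        ∑ U : OddSet n, ∑ M : PMatch n, (if U.1.card = t ∧ cc U M = c then (1 : ℝ) else 0) := by
      rw [Qset, Finset.card_filter, Nat.cast_sum, Fintype.sum_prod_type]
      refine sum_congr rfl fun U _ => sum_congr rfl fun M _ => ?_
      split_ifs <;> simp
    have e2 : ∀ U : OddSet n, (∑ M : PMatch n, (if U.1.card = t ∧ cc U M = c then (1 : ℝ) else 0)) *
        ((c.factorial * (2 ^ i * i.factorial) * (2 ^ i' * i'.factorial) : ℕ) : ℝ) =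
        (if U.1.card = t then (1 : ℝ) else 0) * ((t.factorial * (n - t).factorial : ℕ) : ℝ) := by
      intro U
      by_cases hUt : U.1.card = t
      · rw [if_pos hUt, one_mul, ← htot U hUt c i i' hci hci']
        congr 1
        have key := sum_pmatch_level_eq U hUt (r := 1) (fun _ => 1) (fun _ => 1) (c := c)
        simp only [Matrix.mul_one, trace_one, Fintype.card_fin, Nat.cast_one, dite_eq_ite] at key
        rw [key]
        have hall : ∀ M' ∈ (perfectMatchings (univ : Finset (Fin n))).filter
            (fun M' => (M'.filter fun e => cutCount U.1 e = 1).card = c),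
            (if IsPMOn (univ : Finset (Fin n)) M' then (1 : ℝ) else 0) = 1 := by
          intro M' hM'
          rw [if_pos (mem_perfectMatchings.1 (mem_filter.1 hM').1)]
        rw [sum_congr rfl hall, sum_const, nsmul_eq_mul, mul_one]
      · rw [if_neg hUt, zero_mul]
        have : ∀ M : PMatch n, (if U.1.card = t ∧ cc U M = c then (1 : ℝ) else 0) = 0 :=
          fun M => if_neg fun h => hUt h.1
        rw [Fintype.sum_congr _ _ this]
        simp
    rw [e1, sum_mul, sum_mul]
    exact Fintype.sum_congr _ _ e2
  -- Step 4: assemble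
  rw [hval]
  have hterm : ∀ c ∈ C, w c / ((Qset n t c).card : ℝ) *
      ∑ U : OddSet n, ∑ M : PMatch n, (if U.1.card = t ∧ cc U M = c then (X U * Y M).trace else 0) =
      (∑ U : OddSet n, (if U.1.card = t then (1 : ℝ) else 0))⁻¹ * ∑ U : OddSet n, w c * (P U).eval (c : ℝ) := by
    intro c hc
    obtain ⟨hcodd, -, hcT, hne⟩ := hC c hc
    obtain ⟨p, hp⟩ := hne
    -- `n` is even: there is a perfect matching
    have hn : 2 * p.2.1.card = n := by rw [two_mul_card_eq p.2.2, card_univ, Fintype.card_fin]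
    have hct : c ≤ t := hcT.trans hTt
    obtain ⟨i, hi⟩ : ∃ i, c + 2 * i = t := by
      obtain ⟨a, ha⟩ := hcodd; obtain ⟨b, hb⟩ := htodd; exact ⟨b - a, by omega⟩
    obtain ⟨i', hi'⟩ : ∃ i', c + 2 * i' = n - t := by
      obtain ⟨a, ha⟩ := hcodd; obtain ⟨b, hb⟩ := htodd; exact ⟨p.2.1.card - a - b - 1, by omega⟩
    have hQc := hQ c i i' hi hi'
    have hQ0 : ((Qset n t c).card : ℝ) ≠ 0 := by exact_mod_cast (card_pos.2 ⟨p, hp⟩).ne'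
    have hK : (0 : ℝ) < ((c.factorial * (2 ^ i * i.factorial) * (2 ^ i' * i'.factorial) : ℕ) : ℝ) := by positivity
    have hN0 : (∑ U : OddSet n, (if U.1.card = t then (1 : ℝ) else 0)) ≠ 0 := by
      intro h0; rw [h0, zero_mul] at hQc; exact (mul_ne_zero hQ0 hK.ne') hQc
    have hF0 : ((t.factorial * (n - t).factorial : ℕ) : ℝ) ≠ 0 := by positivity
    -- per cut: Σ_M = total_U · P_U(c), and total_U · K = t!(n-t)!
    have hU : ∀ U : OddSet n, (∑ M : PMatch n, (if U.1.card = t ∧ cc U M = c then (X U * Y M).trace else 0)) *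
        ((c.factorial * (2 ^ i * i.factorial) * (2 ^ i' * i'.factorial) : ℕ) : ℝ) =
        ((t.factorial * (n - t).factorial : ℕ) : ℝ) * (P U).eval (c : ℝ) := by
      intro U
      by_cases hUt : U.1.card = t
      · rw [hPval U hUt c i i' hi hi', mul_right_comm, htot U hUt c i i' hi hi']
      · rw [hPzero U hUt]
        have : ∀ M : PMatch n, (if U.1.card = t ∧ cc U M = c then (X U * Y M).trace else 0) = 0 :=
          fun M => if_neg fun h => hUt h.1
        rw [Fintype.sum_congr _ _ this]
        simp
    -- |Q_c| = N_t · t!(n-t)!/K, Σ_U Σ_M = (t!(n-t)!/K) Σ_U P_U(c)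
    have hQc' : ((Qset n t c).card : ℝ) =
        (∑ U : OddSet n, (if U.1.card = t then (1 : ℝ) else 0)) * ((t.factorial * (n - t).factorial : ℕ) : ℝ) /
          ((c.factorial * (2 ^ i * i.factorial) * (2 ^ i' * i'.factorial) : ℕ) : ℝ) := by
      rw [eq_div_iff hK.ne', hQc]
    have hS : (∑ U : OddSet n, ∑ M : PMatch n, (if U.1.card = t ∧ cc U M = c then (X U * Y M).trace else 0)) =
        ((t.factorial * (n - t).factorial : ℕ) : ℝ) /
          ((c.factorial * (2 ^ i * i.factorial) * (2 ^ i' * i'.factorial) : ℕ) : ℝ) *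
          ∑ U : OddSet n, (P U).eval (c : ℝ) := by
      rw [mul_sum]
      refine Fintype.sum_congr _ _ fun U => ?_
      rw [div_mul_eq_mul_div, eq_div_iff hK.ne', hU U]
    rw [hS, hQc', mul_sum, mul_sum, mul_sum]
    refine Fintype.sum_congr _ _ fun U => ?_
    field_simp
  rw [sum_congr rfl hterm, ← mul_sum, sum_comm]
  have hinner : ∀ U : OddSet n, ∑ c ∈ C, w c * (P U).eval (c : ℝ) = -(P U).eval 0 :=
    fun U => hexact (P U) (hPdeg U)
  rw [Fintype.sum_congr _ _ hinner]
  refine mul_nonpos_of_nonneg_of_nonpos (inv_nonneg.2 (sum_nonneg fun U _ => by split_ifs <;> norm_num)) ?_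
  rw [sum_neg_distrib, neg_nonpos]
  exact sum_nonneg fun U _ => hP0 U

/-- **BC5 rung, matching side**: for every balanced exact design of degree `dq n` on levels `≤ Tq n` and
every psd pair `(X, Y)` of any dimension `r` with `Y_M` depending only on the edges of `M` at a window `A`
with `|A| ≤ dq n` (`X` arbitrary), the design value `(Σ_U Σ_M W(U,M)·tr(X_U Y_M))/r` is `≤ 0`. Together
with `juntaVirtualPositivity_bal` (cut side): a one-sided junta on EITHER side has nonpositive value.
[folklore] -/
theorem juntaVirtualPositivity_bal_matching {t : ℕ} {Bv : ℝ} {C : Finset ℕ} {w : ℕ → ℝ}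
    (hdes : IsBalancedDesign n t (Tq n) (dq n) Bv C w) {r : ℕ} (A : Finset (Fin n)) (hA : A.card ≤ dq n)
    (X : OddSet n → Matrix (Fin r) (Fin r) ℝ) (Y : PMatch n → Matrix (Fin r) (Fin r) ℝ)
    (hY : ∀ M M' : PMatch n, M.1.filter (fun e => ∃ a ∈ A, a ∈ e) = M'.1.filter (fun e => ∃ a ∈ A, a ∈ e) →
      Y M = Y M')
    (hXpsd : ∀ U, (X U).PosSemidef) (hYpsd : ∀ M, (Y M).PosSemidef) :
    (∑ U, ∑ M, levelWeight n t C w U M * (X U * Y M).trace) / r ≤ 0 :=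
  div_nonpos_iff.2 (Or.inr ⟨sum_levelWeight_trace_nonpos_of_junta_matching hdes.1 A hA X Y hY hXpsd hYpsd,
    Nat.cast_nonneg r⟩)

end DesignM

end Summit.PneNP.PneNP.Theorems.ChebyshevTracialDesignJunta
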